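import Summits.QuantumAdvantage.QuantumAdvantage.Theses.CubicForrelation
import Summits.QuantumAdvantage.QuantumAdvantage.Theorems.NearExactIsExact.Negative.MmPairFixedPoints

/-!
# `NearExactIsExact` (stmt-QuantumAdvantage-14043) — negative side: BOTH degree hypotheses are load-bearing,
  quantitatively (`Φ = 1 − 2^{1−d}` for a quadratic/degree-`d` pair at every even `n ≥ 2d`)

Disprover seat `b2b-cforr-disprove-g10` (2026-08-20).  HONEST FRAMING: kernel-checked NEGATIVE LEMMAS about the crux
`Summit.QuantumAdvantage.QuantumAdvantage.Theses.CubicForrelation.NearExactIsExact`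
(`∃ θ < 1, ∀ even n, ∀ cubic f g, Φ(f,g) > θ ⇒ Φ(f,g) = 1`); they say which hypotheses any proof must use and bound
every mixed-degree generalisation from below.  They are NOT summit progress and do not decide the crux.

**The family.** On `n = m + m` bits, `m = d + k`, let `f = IP` (the inner product `x₁·x₂`, QUADRATIC) and
`g = IP ⊕ 1_A` with `A = {y : y₂ ∈ 0^d × 𝔽₂^k}` (the indicator of a coordinate flat of codimension `d` inside the
second block; `deg g = d` for `d ≥ 2`).  Both are two-sided Maiorana–McFarland sign forms with `π = τ = id`, so the
landed fixed-point formula `Negative.MmPairFixedPoints.forrelation_mmPair_of_leftInverse` evaluates the pair in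
closed form:

  `Φ(IP, IP ⊕ 1_A) = 2^{-m} Σ_{y₂} (−1)^{1_A(y₂)} = 1 − 2·|A|/2^m = 1 − 2^{1−d}`     (`forrelation_fIP_gFlip`),

independently of `k`, i.e. at EVERY even `n ≥ 2d`.  Consequences (all `sorry`-free, standard axioms):

* `nearExactIsExact_false_without_degG`, `nearExactIsExact_false_without_degF` — dropping EITHER cubicity
  hypothesis makes the crux false: `¬ ∃ θ < 1, ∀ even n, ∀ f g, deg f ≤ 3 → θ < Φ(f,g) → Φ(f,g) = 1` and the
  mirror statement with `deg g ≤ 3` (the latter is literally `¬ CruxWithoutDegF` of the crux work file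
  `Cruxes/NearExactIsExact/Disproof.lean` §4, where it stood as a `sorry` with a harder 𝔽_{2^r}-pencil witness;
  here the witness is the inner product against its own point-flipped copy, `d = m → ∞`).
* `mixed_threshold_ge` — for every `d ≥ 2`: any `θ` isolating exactness among pairs (`deg f ≤ 3`, `deg g ≤ d`) on
  all even `n` satisfies `θ ≥ 1 − 2^{1−d}` (`d = 4`: `7/8`; `d = 5`: `15/16`; `d = 6`: `31/32`), because the value
  `1 − 2^{1−d} ≠ 1` is attained at every even `n ≥ 2d`.  For `d = 3` the family only gives `3/4 < 13/16`
  (the cubic record at `n = 8` is NOT of this shape), consistent with everything landed under `Negative/`.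

Mechanism in one line: flipping a bent function on a set `A` moves its forrelation with the old dual by exactly
`2|A|/2^n` (`bb_forrelation_eq_of_dual`-type accounting); cubic flips have `|A| ≥ 2^{n−3}` (Reed–Muller), degree-`d`
flips only `|A| ≥ 2^{n−d}` — the degree bound on the FREE side is exactly what keeps `Φ` away from `1`.
References (orientation only; everything here is proved from the tree): R. L. McFarland, JCTA 15 (1973) and
C. Carlet, *Boolean Functions for Cryptography and Coding Theory* (CUP 2021) §6.1 (Maiorana–McFarland functions and
their duals); S. Aaronson, A. Ambainis, Forrelation, SIAM J. Comput. 47 (2018) §1.1.1 (definition of `Φ`). [folklore]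
-/

set_option linter.dupNamespace false -- D-0017: single-problem summit ⇒ `QuantumAdvantage.QuantumAdvantage` by design

noncomputable section

namespace Summit.QuantumAdvantage.QuantumAdvantage.Theorems.NearExactIsExact.Negative.DegreeHypotheses

open Finset
open Literature.Computability.QuantumComplexity
open Literature.Computability.QuantumComplexity.Simon (twist_eq_neg_one_pow)
open Literature.Computability.QuantumComplexity.BuzetChailloux (zeroVec)
open Summit.QuantumAdvantage.QuantumAdvantage.Theses.CubicForrelation (NearExactIsExact)
open Summit.QuantumAdvantage.QuantumAdvantage.Theorems.NearExactIsExact.Negative.MmPairFixedPoints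
  (forrelation_mmPair_of_leftInverse)

variable {a b m d k : ℕ}

/-! ### Blocks of an appended bit vector -/

/-- The first block `x₁` of `x = x₁ ‖ x₂ ∈ 𝔽₂^{a+b}`. [folklore] -/
def lo (x : Fin (a + b) → Bool) : Fin a → Bool := fun i => x (Fin.castAdd b i)

/-- The second block `x₂` of `x = x₁ ‖ x₂ ∈ 𝔽₂^{a+b}`. [folklore] -/
def hi (x : Fin (a + b) → Bool) : Fin b → Bool := fun i => x (Fin.natAdd a i)

/-- `lo (x₁ ‖ x₂) = x₁`. [folklore] -/
@[simp] theorem lo_append (x₁ : Fin a → Bool) (x₂ : Fin b → Bool) : lo (Fin.append x₁ x₂) = x₁ := by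
  funext i; simp [lo]

/-- `hi (x₁ ‖ x₂) = x₂`. [folklore] -/
@[simp] theorem hi_append (x₁ : Fin a → Bool) (x₂ : Fin b → Bool) : hi (Fin.append x₁ x₂) = x₂ := by
  funext i; simp [hi]

/-! ### The inner product as an explicit quadratic polynomial -/

/-- `IP = Σ_{i<m} X_i X_{m+i} ∈ 𝔽₂[X_0,…,X_{2m-1}]`. [cite: Carlet2020, §6.1] -/
def ipPoly (m : ℕ) : MvPolynomial (Fin (m + m)) (ZMod 2) :=
  ∑ i : Fin m, MvPolynomial.X (Fin.castAdd m i) * MvPolynomial.X (Fin.natAdd m i)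

/-- `deg IP ≤ 2`. [cite: Carlet2020, §6.1] -/
theorem totalDegree_ipPoly (m : ℕ) : (ipPoly m).totalDegree ≤ 2 := by
  refine (MvPolynomial.totalDegree_finsetSum _ _).trans (Finset.sup_le fun i _ => ?_)
  refine (MvPolynomial.totalDegree_mul _ _).trans ?_
  rw [MvPolynomial.totalDegree_X, MvPolynomial.totalDegree_X]

/-- `IP(x₁ ‖ x₂) = #{i : x₁ᵢ ∧ x₂ᵢ} (mod 2)`. [cite: Carlet2020, §6.1] -/
theorem eval_ipPoly (x : Fin (m + m) → Bool) :
    MvPolynomial.eval (fun j => if x j then (1 : ZMod 2) else 0) (ipPoly m) =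
      ((univ.filter fun i => lo x i && hi x i).card : ZMod 2) := by
  simp only [ipPoly, map_sum, map_mul, MvPolynomial.eval_X]
  have e : ∀ i : Fin m, ((if x (Fin.castAdd m i) then (1 : ZMod 2) else 0) *
      (if x (Fin.natAdd m i) then (1 : ZMod 2) else 0)) = if (lo x i && hi x i) = true then 1 else 0 := by
    intro i
    simp only [lo, hi]
    rcases Bool.eq_false_or_eq_true (x (Fin.castAdd m i)) with h | h <;> simp [h]
  rw [sum_congr rfl fun i _ => e i, sum_boole]

/-- The cubic (indeed quadratic) side of the family: `f = IP` on `m + m` bits. [cite: Carlet2020, §6.1] -/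
def fIP (m : ℕ) : (Fin (m + m) → Bool) → Bool := polyPhase (ipPoly m)

/-- `deg IP ≤ 2`. [cite: Carlet2020, §6.1] -/
theorem isDegLeFun_fIP (m : ℕ) : IsDegLeFun 2 (fIP m) := isDegLeFun_polyPhase (totalDegree_ipPoly m)

/-- `IP(x) = [#{i : x₁ᵢ ∧ x₂ᵢ} odd]`. [cite: Carlet2020, §6.1] -/
theorem fIP_eq (x : Fin (m + m) → Bool) : fIP m x = decide (Odd (univ.filter fun i => lo x i && hi x i).card) := by
  rw [fIP, polyPhase_apply, eval_ipPoly]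
  by_cases h : Odd (univ.filter fun i => lo x i && hi x i).card
  · rw [decide_eq_true h, decide_eq_true (ZMod.natCast_eq_one_iff_odd.mpr h)]
  · rw [decide_eq_false h, decide_eq_false (fun h' => h (ZMod.natCast_eq_one_iff_odd.mp h'))]

/-- `(-1)^{IP(x₁ ‖ x₂)} = (-1)^{x₁·x₂}`. [cite: Carlet2020, §6.1] -/
theorem signOf_fIP (x : Fin (m + m) → Bool) : signOf (fIP m x) = twist (lo x) (hi x) := by
  rw [fIP_eq, twist_eq_neg_one_pow]
  rcases Nat.even_or_odd (univ.filter fun i => lo x i && hi x i).card with h | h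
  · rw [h.neg_one_pow, decide_eq_false (Nat.not_odd_iff_even.mpr h)]; rfl
  · rw [h.neg_one_pow, decide_eq_true h]; rfl

/-- `IP` in Maiorana–McFarland sign form with `τ = id`, `r = 0`: `(-1)^{IP(x₁ ‖ x₂)} = (-1)^{x₂·x₁}·(-1)^0`.
[cite: Carlet2020, §6.1] -/
theorem signOf_fIP_append (x₁ x₂ : Fin m → Bool) :
    signOf (fIP m (Fin.append x₁ x₂)) = twist x₂ (id x₁) * signOf false := by
  rw [signOf_fIP, lo_append, hi_append, twist_comm]
  simp [signOf]

/-! ### The free side: `IP` flipped on a coordinate flat of codimension `d` -/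

/-- `1_A = Π_{i<d} (1 + X_{m+i})`, `A = {y : (y₂)_i = 0 for i < d}`, on `m + m` bits with `m = d + k`. [folklore] -/
def flatPoly (d k : ℕ) : MvPolynomial (Fin ((d + k) + (d + k))) (ZMod 2) :=
  ∏ i : Fin d, (1 + MvPolynomial.X (Fin.natAdd (d + k) (Fin.castAdd k i)))

/-- `deg 1_A ≤ d`. [folklore] -/
theorem totalDegree_flatPoly (d k : ℕ) : (flatPoly d k).totalDegree ≤ d := by
  refine (MvPolynomial.totalDegree_finsetProd _ _).trans ?_
  have e : ∀ i : Fin d,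
      (1 + MvPolynomial.X (R := ZMod 2) (Fin.natAdd (d + k) (Fin.castAdd k i))).totalDegree ≤ 1 := by
    intro i
    refine (MvPolynomial.totalDegree_add _ _).trans ?_
    rw [MvPolynomial.totalDegree_one, MvPolynomial.totalDegree_X]
    simp
  calc ∑ i : Fin d, (1 + MvPolynomial.X (R := ZMod 2) (Fin.natAdd (d + k) (Fin.castAdd k i))).totalDegree
      ≤ ∑ _i : Fin d, 1 := sum_le_sum fun i _ => e i
    _ = d := by simp

/-- `1_A(y) = [lo (hi y) = 0]`. [folklore] -/
theorem eval_flatPoly (y : Fin ((d + k) + (d + k)) → Bool) :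
    MvPolynomial.eval (fun j => if y j then (1 : ZMod 2) else 0) (flatPoly d k) =
      if lo (hi y) = zeroVec then 1 else 0 := by
  simp only [flatPoly, map_prod, map_add, map_one, MvPolynomial.eval_X]
  have e : ∀ i : Fin d, (1 : ZMod 2) + (if y (Fin.natAdd (d + k) (Fin.castAdd k i)) then 1 else 0) =
      if y (Fin.natAdd (d + k) (Fin.castAdd k i)) = false then 1 else 0 := by
    intro i
    rcases Bool.eq_false_or_eq_true (y (Fin.natAdd (d + k) (Fin.castAdd k i))) with h | h
    · rw [h]; decide
    · rw [h]; decide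
  rw [prod_congr rfl fun i _ => e i]
  by_cases h : lo (hi y) = zeroVec
  · rw [if_pos h]
    exact prod_eq_one fun i _ => if_pos (congrFun h i :)
  · rw [if_neg h]
    have h' : ∃ i, lo (hi y) i ≠ false := by
      by_contra hall
      push Not at hall
      exact h (funext hall)
    obtain ⟨i, hi⟩ := h'
    exact prod_eq_zero (mem_univ i) (if_neg hi)

/-- The free side of the family: `g = IP ⊕ 1_A`. [folklore] -/
def gFlip (d k : ℕ) : (Fin ((d + k) + (d + k)) → Bool) → Bool := polyPhase (ipPoly (d + k) + flatPoly d k)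

/-- `deg (IP ⊕ 1_A) ≤ d` for `d ≥ 2`. [folklore] -/
theorem isDegLeFun_gFlip (hd : 2 ≤ d) (k : ℕ) : IsDegLeFun d (gFlip d k) := by
  refine isDegLeFun_polyPhase ((MvPolynomial.totalDegree_add _ _).trans (max_le ?_ (totalDegree_flatPoly d k)))
  exact (totalDegree_ipPoly (d + k)).trans hd

/-- `[a + b = 1] = [a = 1] ⊕ [b = 1]` in `𝔽₂`. [folklore] -/
theorem zmod2_decide_add : ∀ u v : ZMod 2, decide (u + v = 1) = (decide (u = 1) ^^ decide (v = 1)) := by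
  decide

/-- The indicator bit `1_A(y₂) = [lo y₂ = 0]`. [folklore] -/
def flatBit (y₂ : Fin (d + k) → Bool) : Bool := decide (lo y₂ = (zeroVec : Fin d → Bool))

/-- `g(y) = IP(y) ⊕ 1_A(y₂)`. [folklore] -/
theorem gFlip_eq (y : Fin ((d + k) + (d + k)) → Bool) : gFlip d k y = (fIP (d + k) y ^^ flatBit (hi y)) := by
  rw [gFlip, polyPhase_apply, map_add, zmod2_decide_add, ← polyPhase_apply, ← fIP, eval_flatPoly, flatBit]
  by_cases h : lo (hi y) = zeroVec
  · rw [if_pos h, decide_eq_true h]; simp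
  · rw [if_neg h, decide_eq_false h]; simp

/-- `g` in Maiorana–McFarland sign form with `π = id`, `h = 1_A`:
`(-1)^{g(y₁ ‖ y₂)} = (-1)^{y₁·y₂}·(-1)^{1_A(y₂)}`. [folklore] -/
theorem signOf_gFlip_append (y₁ y₂ : Fin (d + k) → Bool) :
    signOf (gFlip d k (Fin.append y₁ y₂)) = twist y₁ (id y₂) * signOf (flatBit (d := d) (k := k) y₂) := by
  rw [gFlip_eq, signOf_xor, signOf_fIP, lo_append, hi_append]
  rfl

/-! ### The value of the pair -/

/-- `Σ_{y₂ ∈ 𝔽₂^{d+k}} (-1)^{1_A(y₂)} = 2^k (2^d − 2)` (`|A| = 2^k` inside the second block). [folklore] -/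
theorem sum_signOf_flatBit (d k : ℕ) :
    ∑ y₂ : Fin (d + k) → Bool, signOf (flatBit (d := d) (k := k) y₂) = (2 : ℝ) ^ k * ((2 : ℝ) ^ d - 2) := by
  rw [sum_append]
  simp only [flatBit, lo_append]
  rw [Finset.sum_comm]
  simp only [sum_const, card_univ, Fintype.card_fun, Fintype.card_bool, Fintype.card_fin, nsmul_eq_mul,
    Nat.cast_pow, Nat.cast_ofNat]
  congr 1
  have e : ∀ u : Fin d → Bool, signOf (decide (u = zeroVec)) = 1 - 2 * (if u = zeroVec then (1 : ℝ) else 0) := by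
    intro u
    by_cases h : u = zeroVec
    · rw [if_pos h, decide_eq_true h]; norm_num [signOf]
    · rw [if_neg h, decide_eq_false h]; norm_num [signOf]
  rw [sum_congr rfl fun u _ => e u, sum_sub_distrib, ← mul_sum, sum_ite_eq' univ (zeroVec : Fin d → Bool),
    if_pos (mem_univ _), sum_const, card_univ, Fintype.card_fun, Fintype.card_bool, Fintype.card_fin]
  simp

/-- **The value**: `Φ(IP, IP ⊕ 1_A) = 1 − 2^{1−d}` on `n = 2(d + k)` bits, for every `k`.
[cite: AaronsonAmbainis2018, §1.1.1] -/
theorem forrelation_fIP_gFlip (d k : ℕ) : forrelation (fIP (d + k)) (gFlip d k) = 1 - 2 / (2 : ℝ) ^ d := by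
  rw [forrelation_mmPair_of_leftInverse (fIP (d + k)) (gFlip d k) id id (flatBit (d := d) (k := k))
    (fun _ => false) (signOf_gFlip_append) (signOf_fIP_append) (fun _ => rfl)]
  simp only [signOf, Bool.false_eq_true, if_false, mul_one]
  rw [show (∑ y₂ : Fin (d + k) → Bool, if flatBit (d := d) (k := k) y₂ = true then (-1 : ℝ) else 1) =
      ∑ y₂ : Fin (d + k) → Bool, signOf (flatBit (d := d) (k := k) y₂) from rfl, sum_signOf_flatBit, pow_add]
  have h1 : (2 : ℝ) ^ d ≠ 0 := by positivity
  have h2 : (2 : ℝ) ^ k ≠ 0 := by positivity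
  field_simp

/-- `Φ` is symmetric. [cite: AaronsonAmbainis2018, §1.1.1] -/
theorem forrelation_symm (f g : (Fin m → Bool) → Bool) : forrelation g f = forrelation f g := by
  unfold forrelation
  congr 1
  rw [sum_comm]
  refine sum_congr rfl fun x _ => sum_congr rfl fun y _ => ?_
  rw [twist_comm y x]; ring

/-- The mirrored value: `Φ(IP ⊕ 1_A, IP) = 1 − 2^{1−d}`. [cite: AaronsonAmbainis2018, §1.1.1] -/
theorem forrelation_gFlip_fIP (d k : ℕ) : forrelation (gFlip d k) (fIP (d + k)) = 1 - 2 / (2 : ℝ) ^ d := by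
  rw [forrelation_symm, forrelation_fIP_gFlip]

/-- **Mixed-degree non-exact pairs at every even `n ≥ 2d`**: a quadratic `f` and a degree-`≤ d` `g` with
`Φ(f,g) = 1 − 2^{1−d}` (`d ≥ 2`). [folklore] -/
theorem exists_mixed_pair (hd : 2 ≤ d) (k : ℕ) :
    ∃ f g : (Fin ((d + k) + (d + k)) → Bool) → Bool,
      IsDegLeFun 2 f ∧ IsDegLeFun d g ∧ forrelation f g = 1 - 2 / (2 : ℝ) ^ d :=
  ⟨fIP (d + k), gFlip d k, isDegLeFun_fIP (d + k), isDegLeFun_gFlip hd k, forrelation_fIP_gFlip d k⟩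

/-! ### Consequences for the crux -/

/-- For `θ < 1` there is a `d ≥ 2` with `θ < 1 − 2^{1−d}`. [folklore] -/
theorem exists_d_of_lt_one {θ : ℝ} (hθ : θ < 1) : ∃ d : ℕ, 2 ≤ d ∧ θ < 1 - 2 / (2 : ℝ) ^ d := by
  obtain ⟨d, hd⟩ := exists_pow_lt_of_lt_one (show 0 < (1 - θ) / 2 by linarith) (show (1 : ℝ) / 2 < 1 by norm_num)
  refine ⟨d + 2, by omega, ?_⟩
  have h4 : (2 : ℝ) / 2 ^ (d + 2) = ((1 : ℝ) / 2) ^ d / 2 := by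
    rw [pow_add, one_div_pow]; field_simp
  rw [h4]
  linarith

/-- **Cubicity of `g` is load-bearing**: with `deg g` unconstrained the crux is false — for every `θ < 1` the pair
(`IP`, `IP ⊕ 1_A`) with `codim A = d` large has `θ < Φ = 1 − 2^{1−d} < 1`. [folklore] -/
theorem nearExactIsExact_false_without_degG :
    ¬ ∃ θ : ℝ, θ < 1 ∧ ∀ n : ℕ, Even n → ∀ f g : (Fin n → Bool) → Bool, IsDegLeFun 3 f →
        θ < forrelation f g → forrelation f g = 1 := by
  rintro ⟨θ, hθ, h⟩
  obtain ⟨d, -, hd⟩ := exists_d_of_lt_one hθ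
  have hv := forrelation_fIP_gFlip d 0
  have h1 := h ((d + 0) + (d + 0)) ⟨d + 0, rfl⟩ (fIP (d + 0)) (gFlip d 0)
    ((isDegLeFun_fIP (d + 0)).mono (by norm_num)) (by rw [hv]; exact hd)
  rw [hv] at h1
  have h2 : (0 : ℝ) < 2 / (2 : ℝ) ^ d := by positivity
  linarith

/-- **Cubicity of `f` is load-bearing** (literally `¬ CruxWithoutDegF` of `Cruxes/NearExactIsExact/Disproof.lean` §4,
there a `sorry`): with `deg f` unconstrained the crux is false, by the mirrored pair. [folklore] -/
theorem nearExactIsExact_false_without_degF :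
    ¬ ∃ θ : ℝ, θ < 1 ∧ ∀ n : ℕ, Even n → ∀ f g : (Fin n → Bool) → Bool, IsDegLeFun 3 g →
        θ < forrelation f g → forrelation f g = 1 := by
  rintro ⟨θ, hθ, h⟩
  obtain ⟨d, -, hd⟩ := exists_d_of_lt_one hθ
  have hv := forrelation_gFlip_fIP d 0
  have h1 := h ((d + 0) + (d + 0)) ⟨d + 0, rfl⟩ (gFlip d 0) (fIP (d + 0))
    ((isDegLeFun_fIP (d + 0)).mono (by norm_num)) (by rw [hv]; exact hd)
  rw [hv] at h1
  have h2 : (0 : ℝ) < 2 / (2 : ℝ) ^ d := by positivity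
  linarith

/-- **Quantitative version**: for `d ≥ 2`, every threshold `θ` that isolates exactness among pairs with `deg f ≤ 3`,
`deg g ≤ d` on all even `n` satisfies `1 − 2^{1−d} ≤ θ` — the mixed-degree isolation constant, if it exists, is
at least `7/8` (`d = 4`), `15/16` (`d = 5`), `31/32` (`d = 6`), … . [folklore] -/
theorem mixed_threshold_ge (hd : 2 ≤ d) {θ : ℝ}
    (h : ∀ n : ℕ, Even n → ∀ f g : (Fin n → Bool) → Bool, IsDegLeFun 3 f → IsDegLeFun d g →
        θ < forrelation f g → forrelation f g = 1) : 1 - 2 / (2 : ℝ) ^ d ≤ θ := by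
  by_contra hlt
  rw [not_le] at hlt
  have hv := forrelation_fIP_gFlip d 0
  have h1 := h ((d + 0) + (d + 0)) ⟨d + 0, rfl⟩ (fIP (d + 0)) (gFlip d 0)
    ((isDegLeFun_fIP (d + 0)).mono (by norm_num)) (isDegLeFun_gFlip hd 0) (by rw [hv]; exact hlt)
  rw [hv] at h1
  have h2 : (0 : ℝ) < 2 / (2 : ℝ) ^ d := by positivity
  linarith

end Summit.QuantumAdvantage.QuantumAdvantage.Theorems.NearExactIsExact.Negative.DegreeHypotheses

end
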